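import Summits.CriticalPhenomena.PercolationContinuityZ3.Theorems.PercNearOneGluingNoHeavyLowerTailBlockQ9Tournament
import Summits.CriticalPhenomena.PercolationContinuityZ3.Theorems.PercNearOneGluingNoHeavyLowerTailBlockQ9TieEdge
import Summits.CriticalPhenomena.PercolationContinuityZ3.Theorems.PercNearOneGluingNoHeavyLowerTailBlockQ9CoinContinuity
import HarnessLib

/-!
# `NoHeavyLowerTail` (stmt-CriticalPhenomena-4575) — Question 9 for a glued one-layer block with three dangerous
# pairs from the POINTWISE DICHOTOMY (connectedness of `[0,1]`)

Support file (hull-port / coupling seat `prim-hp-1` gen 12; `--supports stmt-CriticalPhenomena-4575`).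
No definitions, no named facts, no sorries.  Memo `run/shared/lean/prim/prim-hp-1/HULLPORT-COUPLING.md` §51(p), §52.

Three dangerous boundary pairs `e_j = s(p_j, q_j)` (`j : Fin 3`, weights `ρ_j ∈ (0,1)`) of a glued one-layer block,
`a` dominated by every `p_j` in the unglued graph `w`.  The diagonal sub-family `F(0; t, θ)` of tournament
certificates (`BlockQ9.blockQ9_threeDangerous_of_tournament`): anchor `0` beats `1` and `2` with probability `t`,
`1` beats `2` with probability `θ`; `c j x` is the weight of `e_j` thinned by the coin `x` (`ρx/(1 − ρ + ρx)`).
Components `W₀(t) = w[e₀ ↦ 1, e₁ ↦ c 1 t, e₂ ↦ c 2 t]`, `W₁(t,θ) = w[e₁ ↦ 1, e₀ ↦ c 0 (1−t), e₂ ↦ c 2 θ]`,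
`W₂(t,θ) = w[e₂ ↦ 1, e₀ ↦ c 0 (1−t), e₁ ↦ c 1 (1−θ)]`, glued component `w[e₀, e₁, e₂ ↦ 1]`.

* `BlockQ9.blockQ9_threeDangerous_of_PD` — if for every `t ∈ [0,1]` either `W₀(t)` is valid (`a` dominated by
  `p₀`) or some `θ ∈ [0,1]` makes `W₁(t,θ)` and `W₂(t,θ)` valid, and the glued component is valid, then BQ.
  Proof: `{t : W₀(t) valid} ∋ 1` (Lemma 3(i)) and `{t : ∃θ …} ∋ 0` (tie edge, `BlockQ9.exists_theta_anchored`) are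
  closed (`BlockQ9.continuousOn_real_update_two`; the second is the projection of a compact set), cover the
  connected `[0,1]`, hence meet — at a common `t` the family is a tournament certificate.  Which anchor should be
  the distinguished one is the open analytic question (memo §52: not always the anchor of maximal slack).
[cite: KozmaNitzan2024, Lemma 3(i) (pp. 6–7), Lemma 5 (p. 13), Thm. 4 (pp. 12–14), Question 9 (p. 36)]
-/

namespace Summit.CriticalPhenomena.PercolationContinuityZ3.Theorems

open MeasureTheory Set
open Literature.Probability.LatticeModels
open Literature.Probability.Percolation

noncomputable section
open Classical

namespace BlockQ9

variable {n : ℕ}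

/-- **Question 9 for a glued one-layer block with three dangerous pairs, from the pointwise dichotomy.**
See the file header.  `c j x` is the thinned weight of `e_j` by the coin `x` (`hc`); `hPD` is the dichotomy for the
distinguished anchor `0`; `hval_glued` the validity of the all-glued component for some anchor `jc`.
[cite: KozmaNitzan2024, Lemma 3(i) (pp. 6–7), Lemma 5 (p. 13), Thm. 4 (pp. 12–14), Question 9 (p. 36); this work
(memo §51(p), §52)] -/
theorem blockQ9_threeDangerous_of_PD (w : Sym2 (Fin n) → unitInterval) (O A : Finset (Fin n))
    (a b : Fin n) (hOA : Disjoint O A) (haO : a ∉ O) (hbO : b ∉ O)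
    (hiso : ∀ x ∈ O, ∀ y : Fin n, y ∉ O → y ∉ A → w s(x, y) = 0)
    (p q : Fin 3 → Fin n) (hq : ∀ j, q j ∈ O) (hpA : ∀ j, p j ∈ A) (hpO : ∀ j, p j ∉ O)
    (hinj : Function.Injective fun j => s(p j, q j))
    (hpos : ∀ j, 0 < (w s(p j, q j) : ℝ)) (hlt : ∀ j, (w s(p j, q j) : ℝ) < 1)
    (hdom : ∀ v ∈ A, ∀ o ∈ O, w s(o, v) ≠ 0 → (∀ j, s(o, v) ≠ s(p j, q j)) →
      (prodBernoulli (fun e : Sym2 (Fin n) => if (∃ x ∈ e, x ∈ O) then 0 else w e)).real (openConn a b) ≤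
        (prodBernoulli (fun e : Sym2 (Fin n) => if (∃ x ∈ e, x ∈ O) then 0 else w e)).real (openConn v b))
    (hyp : ∀ j, (prodBernoulli w).real (openConn a b) ≤ (prodBernoulli w).real (openConn (p j) b))
    (c : Fin 3 → ℝ → unitInterval)
    (hc : ∀ j x, 0 ≤ x → x ≤ 1 →
      ((c j x : unitInterval) : ℝ) = (w s(p j, q j) : ℝ) * x / (1 - (w s(p j, q j) : ℝ) + (w s(p j, q j) : ℝ) * x))
    (jc : Fin 3)
    (hval_glued :
      (prodBernoulli (Function.update (Function.update (Function.update w s(p 0, q 0) 1) s(p 1, q 1) 1)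
        s(p 2, q 2) 1)).real (openConn a b) ≤
      (prodBernoulli (Function.update (Function.update (Function.update w s(p 0, q 0) 1) s(p 1, q 1) 1)
        s(p 2, q 2) 1)).real (openConn (p jc) b))
    (hPD : ∀ t : ℝ, 0 ≤ t → t ≤ 1 →
      (prodBernoulli (Function.update (Function.update (Function.update w s(p 0, q 0) 1) s(p 1, q 1) (c 1 t))
          s(p 2, q 2) (c 2 t))).real (openConn a b) ≤
        (prodBernoulli (Function.update (Function.update (Function.update w s(p 0, q 0) 1) s(p 1, q 1) (c 1 t))
          s(p 2, q 2) (c 2 t))).real (openConn (p 0) b) ∨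
      ∃ θ : ℝ, 0 ≤ θ ∧ θ ≤ 1 ∧
        (prodBernoulli (Function.update (Function.update (Function.update w s(p 1, q 1) 1) s(p 0, q 0)
            (c 0 (1 - t))) s(p 2, q 2) (c 2 θ))).real (openConn a b) ≤
          (prodBernoulli (Function.update (Function.update (Function.update w s(p 1, q 1) 1) s(p 0, q 0)
            (c 0 (1 - t))) s(p 2, q 2) (c 2 θ))).real (openConn (p 1) b) ∧
        (prodBernoulli (Function.update (Function.update (Function.update w s(p 2, q 2) 1) s(p 0, q 0)
            (c 0 (1 - t))) s(p 1, q 1) (c 1 (1 - θ)))).real (openConn a b) ≤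
          (prodBernoulli (Function.update (Function.update (Function.update w s(p 2, q 2) 1) s(p 0, q 0)
            (c 0 (1 - t))) s(p 1, q 1) (c 1 (1 - θ)))).real (openConn (p 2) b)) :
    (prodBernoulli (fun e : Sym2 (Fin n) => if (∀ x ∈ e, x ∈ O) ∧ ¬ e.IsDiag then 1 else w e)).real
        (openConn a b ∩ ⋃ o ∈ O, ⋃ x ∈ A, openConn o x) ≤
      (prodBernoulli (fun e : Sym2 (Fin n) => if (∀ x ∈ e, x ∈ O) ∧ ¬ e.IsDiag then 1 else w e)).real
        (⋃ o ∈ O, openConn o b) := by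
  -- names for the pairs and weights
  obtain ⟨e₀, he₀⟩ : ∃ e : Sym2 (Fin n), e = s(p 0, q 0) := ⟨_, rfl⟩
  obtain ⟨e₁, he₁⟩ : ∃ e : Sym2 (Fin n), e = s(p 1, q 1) := ⟨_, rfl⟩
  obtain ⟨e₂, he₂⟩ : ∃ e : Sym2 (Fin n), e = s(p 2, q 2) := ⟨_, rfl⟩
  have h01 : e₀ ≠ e₁ := by rw [he₀, he₁]; intro h; exact absurd (hinj h) (by decide)
  have h02 : e₀ ≠ e₂ := by rw [he₀, he₂]; intro h; exact absurd (hinj h) (by decide)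
  have h12 : e₁ ≠ e₂ := by rw [he₁, he₂]; intro h; exact absurd (hinj h) (by decide)
  obtain ⟨ρ₀, hρ₀⟩ : ∃ t : ℝ, t = (w e₀ : ℝ) := ⟨_, rfl⟩
  obtain ⟨ρ₁, hρ₁⟩ : ∃ t : ℝ, t = (w e₁ : ℝ) := ⟨_, rfl⟩
  obtain ⟨ρ₂, hρ₂⟩ : ∃ t : ℝ, t = (w e₂ : ℝ) := ⟨_, rfl⟩
  have hρ₀pos : 0 < ρ₀ := (by rw [hρ₀, he₀]; exact hpos 0); have hρ₀lt : ρ₀ < 1 := (by rw [hρ₀, he₀]; exact hlt 0)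
  have hρ₁pos : 0 < ρ₁ := (by rw [hρ₁, he₁]; exact hpos 1); have hρ₁lt : ρ₁ < 1 := (by rw [hρ₁, he₁]; exact hlt 1)
  have hρ₂pos : 0 < ρ₂ := (by rw [hρ₂, he₂]; exact hpos 2); have hρ₂lt : ρ₂ < 1 := (by rw [hρ₂, he₂]; exact hlt 2)
  -- the coin weights as real functions
  have hc₀ : ∀ x, 0 ≤ x → x ≤ 1 → ((c 0 x : unitInterval) : ℝ) = ρ₀ * x / (1 - ρ₀ + ρ₀ * x) := by
    intro x hx0 hx1; rw [hc 0 x hx0 hx1, ← he₀, ← hρ₀]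
  have hc₁ : ∀ x, 0 ≤ x → x ≤ 1 → ((c 1 x : unitInterval) : ℝ) = ρ₁ * x / (1 - ρ₁ + ρ₁ * x) := by
    intro x hx0 hx1; rw [hc 1 x hx0 hx1, ← he₁, ← hρ₁]
  have hc₂ : ∀ x, 0 ≤ x → x ≤ 1 → ((c 2 x : unitInterval) : ℝ) = ρ₂ * x / (1 - ρ₂ + ρ₂ * x) := by
    intro x hx0 hx1; rw [hc 2 x hx0 hx1, ← he₂, ← hρ₂]
  have hcone : ∀ j, c j 1 = w s(p j, q j) := by
    intro j; apply Subtype.ext; rw [hc j 1 zero_le_one le_rfl]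
    have : (1:ℝ) - (w s(p j, q j) : ℝ) + (w s(p j, q j) : ℝ) * 1 = 1 := by ring
    rw [this, mul_one, div_one]
  have hc1one := hcone 1; have hc2one := hcone 2; have hc0one := hcone 0
  rw [← he₁] at hc1one; rw [← he₂] at hc2one; rw [← he₀] at hc0one
  rw [← he₀, ← he₁, ← he₂] at hval_glued hPD
  -- the three component families
  obtain ⟨W₀, hW₀⟩ : ∃ W : ℝ → Sym2 (Fin n) → unitInterval,
      W = fun t => Function.update (Function.update (Function.update w e₀ 1) e₁ (c 1 t)) e₂ (c 2 t) := ⟨_, rfl⟩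
  obtain ⟨W₁, hW₁⟩ : ∃ W : ℝ → ℝ → Sym2 (Fin n) → unitInterval,
      W = fun t θ => Function.update (Function.update (Function.update w e₁ 1) e₀ (c 0 (1 - t))) e₂ (c 2 θ) := ⟨_, rfl⟩
  obtain ⟨W₂, hW₂⟩ : ∃ W : ℝ → ℝ → Sym2 (Fin n) → unitInterval,
      W = fun t θ =>
        Function.update (Function.update (Function.update w e₂ 1) e₀ (c 0 (1 - t))) e₁ (c 1 (1 - θ)) := ⟨_, rfl⟩
  have W₀_def : ∀ t, W₀ t = Function.update (Function.update (Function.update w e₀ 1) e₁ (c 1 t)) e₂ (c 2 t) :=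
    fun t => by rw [hW₀]
  have W₁_def : ∀ t θ, W₁ t θ =
      Function.update (Function.update (Function.update w e₁ 1) e₀ (c 0 (1 - t))) e₂ (c 2 θ) :=
    fun t θ => by rw [hW₁]
  have W₂_def : ∀ t θ, W₂ t θ =
      Function.update (Function.update (Function.update w e₂ 1) e₀ (c 0 (1 - t))) e₁ (c 1 (1 - θ)) :=
    fun t θ => by rw [hW₂]
  -- validity functions
  obtain ⟨F₀, hF₀⟩ : ∃ F : ℝ → ℝ,
      F = fun t => (prodBernoulli (W₀ t)).real (openConn (p 0) b) - (prodBernoulli (W₀ t)).real (openConn a b) := ⟨_, rfl⟩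
  obtain ⟨F₁, hF₁⟩ : ∃ F : ℝ × ℝ → ℝ, F = fun z =>
      (prodBernoulli (W₁ z.1 z.2)).real (openConn (p 1) b) - (prodBernoulli (W₁ z.1 z.2)).real (openConn a b) := ⟨_, rfl⟩
  obtain ⟨F₂, hF₂⟩ : ∃ F : ℝ × ℝ → ℝ, F = fun z =>
      (prodBernoulli (W₂ z.1 z.2)).real (openConn (p 2) b) - (prodBernoulli (W₂ z.1 z.2)).real (openConn a b) := ⟨_, rfl⟩
  have F₀_def : ∀ t, F₀ t =
      (prodBernoulli (W₀ t)).real (openConn (p 0) b) - (prodBernoulli (W₀ t)).real (openConn a b) :=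
    fun t => by rw [hF₀]
  have F₁_def : ∀ t θ, F₁ (t, θ) =
      (prodBernoulli (W₁ t θ)).real (openConn (p 1) b) - (prodBernoulli (W₁ t θ)).real (openConn a b) :=
    fun t θ => by rw [hF₁]
  have F₂_def : ∀ t θ, F₂ (t, θ) =
      (prodBernoulli (W₂ t θ)).real (openConn (p 2) b) - (prodBernoulli (W₂ t θ)).real (openConn a b) :=
    fun t θ => by rw [hF₂]
  have hPD' : ∀ t : ℝ, 0 ≤ t → t ≤ 1 → 0 ≤ F₀ t ∨ ∃ θ : ℝ, 0 ≤ θ ∧ θ ≤ 1 ∧ 0 ≤ F₁ (t, θ) ∧ 0 ≤ F₂ (t, θ) := by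
    intro t ht0 ht1
    rcases hPD t ht0 ht1 with h | ⟨θ, hθ0, hθ1, h1, h2⟩
    · left; rw [F₀_def, W₀_def]; linarith
    · right; refine ⟨θ, hθ0, hθ1, ?_, ?_⟩
      · rw [F₁_def, W₁_def]; linarith
      · rw [F₂_def, W₂_def]; linarith
  ------------------------------------------------------------------
  -- continuity of the validity functions (bilinear in the coins)
  ------------------------------------------------------------------
  -- continuity of the coin weights
  have cont_c : ∀ (j : Fin 3) (ρ : ℝ), 0 ≤ ρ → ρ < 1 →
      (∀ x, 0 ≤ x → x ≤ 1 → ((c j x : unitInterval) : ℝ) = ρ * x / (1 - ρ + ρ * x)) →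
      ContinuousOn (fun x : ℝ => ((c j x : unitInterval) : ℝ)) (Icc 0 1) := by
    intro j ρ hρ0 hρ hcj
    refine (continuousOn_thin hρ0 hρ).congr ?_
    intro x hx
    exact hcj x hx.1 hx.2
  have cc₀ := cont_c 0 ρ₀ hρ₀pos.le hρ₀lt hc₀
  have cc₁ := cont_c 1 ρ₁ hρ₁pos.le hρ₁lt hc₁
  have cc₂ := cont_c 2 ρ₂ hρ₂pos.le hρ₂lt hc₂
  have sq_sub₁ : MapsTo (fun z : ℝ × ℝ => 1 - z.1) (Icc (0:ℝ) 1 ×ˢ Icc (0:ℝ) 1) (Icc 0 1) := by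
    intro z hz; simp only [mem_prod, mem_Icc] at hz; constructor <;> linarith [hz.1.1, hz.1.2]
  have sq_snd : MapsTo (fun z : ℝ × ℝ => z.2) (Icc (0:ℝ) 1 ×ˢ Icc (0:ℝ) 1) (Icc 0 1) := by
    intro z hz; simp only [mem_prod] at hz; exact hz.2
  have sq_sub₂ : MapsTo (fun z : ℝ × ℝ => 1 - z.2) (Icc (0:ℝ) 1 ×ˢ Icc (0:ℝ) 1) (Icc 0 1) := by
    intro z hz; simp only [mem_prod, mem_Icc] at hz; constructor <;> linarith [hz.2.1, hz.2.2]
  have cz₀ : ContinuousOn (fun z : ℝ × ℝ => ((c 0 (1 - z.1) : unitInterval) : ℝ)) (Icc 0 1 ×ˢ Icc 0 1) :=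
    cc₀.comp (continuous_const.sub continuous_fst).continuousOn sq_sub₁
  have cz₂ : ContinuousOn (fun z : ℝ × ℝ => ((c 2 z.2 : unitInterval) : ℝ)) (Icc 0 1 ×ˢ Icc 0 1) :=
    cc₂.comp continuous_snd.continuousOn sq_snd
  have cz₁ : ContinuousOn (fun z : ℝ × ℝ => ((c 1 (1 - z.2) : unitInterval) : ℝ)) (Icc 0 1 ×ˢ Icc 0 1) :=
    cc₁.comp (continuous_const.sub continuous_snd).continuousOn sq_sub₂
  have m₀ : ∀ Y, ContinuousOn (fun t => (prodBernoulli (W₀ t)).real Y) (Icc 0 1) := by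
    intro Y
    rw [hW₀]
    exact continuousOn_real_update_two (Function.update w e₀ 1) e₁ e₂ h12.symm (c 1) (c 2) (Icc 0 1) cc₁ cc₂ Y
  have m₁ : ∀ Y, ContinuousOn (fun z : ℝ × ℝ => (prodBernoulli (W₁ z.1 z.2)).real Y) (Icc 0 1 ×ˢ Icc 0 1) := by
    intro Y
    rw [hW₁]
    exact continuousOn_real_update_two (Function.update w e₁ 1) e₀ e₂ h02.symm
      (fun z : ℝ × ℝ => c 0 (1 - z.1)) (fun z : ℝ × ℝ => c 2 z.2) (Icc 0 1 ×ˢ Icc 0 1) cz₀ cz₂ Y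
  have m₂ : ∀ Y, ContinuousOn (fun z : ℝ × ℝ => (prodBernoulli (W₂ z.1 z.2)).real Y) (Icc 0 1 ×ˢ Icc 0 1) := by
    intro Y
    rw [hW₂]
    exact continuousOn_real_update_two (Function.update w e₂ 1) e₀ e₁ h01.symm
      (fun z : ℝ × ℝ => c 0 (1 - z.1)) (fun z : ℝ × ℝ => c 1 (1 - z.2)) (Icc 0 1 ×ˢ Icc 0 1) cz₀ cz₁ Y
  have contF₀ : ContinuousOn F₀ (Icc 0 1) := by
    rw [hF₀]; exact (m₀ _).sub (m₀ _)
  have contF₁ : ContinuousOn F₁ (Icc 0 1 ×ˢ Icc 0 1) := by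
    rw [hF₁]; exact (m₁ _).sub (m₁ _)
  have contF₂ : ContinuousOn F₂ (Icc 0 1 ×ˢ Icc 0 1) := by
    rw [hF₂]; exact (m₂ _).sub (m₂ _)
  ------------------------------------------------------------------
  -- the two closed sets covering `[0,1]`
  ------------------------------------------------------------------
  obtain ⟨SA, hSA⟩ : ∃ S : Set ℝ, S = Icc 0 1 ∩ F₀ ⁻¹' (Ici 0) := ⟨_, rfl⟩
  obtain ⟨K, hK⟩ : ∃ S : Set (ℝ × ℝ), S = (Icc 0 1 ×ˢ Icc 0 1 ∩ F₁ ⁻¹' (Ici 0)) ∩ F₂ ⁻¹' (Ici 0) := ⟨_, rfl⟩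
  obtain ⟨ST, hST⟩ : ∃ S : Set ℝ, S = Prod.fst '' K := ⟨_, rfl⟩
  have hSA_closed : IsClosed SA := by
    rw [hSA]; exact contF₀.preimage_isClosed_of_isClosed isClosed_Icc isClosed_Ici
  have hK_closed : IsClosed K := by
    have h1 : IsClosed (Icc (0:ℝ) 1 ×ˢ Icc (0:ℝ) 1 ∩ F₁ ⁻¹' (Ici 0)) :=
      contF₁.preimage_isClosed_of_isClosed (isClosed_Icc.prod isClosed_Icc) isClosed_Ici
    have h2 : IsClosed (Icc (0:ℝ) 1 ×ˢ Icc (0:ℝ) 1 ∩ F₂ ⁻¹' (Ici 0)) :=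
      contF₂.preimage_isClosed_of_isClosed (isClosed_Icc.prod isClosed_Icc) isClosed_Ici
    have : K = (Icc (0:ℝ) 1 ×ˢ Icc (0:ℝ) 1 ∩ F₁ ⁻¹' (Ici 0)) ∩ (Icc (0:ℝ) 1 ×ˢ Icc (0:ℝ) 1 ∩ F₂ ⁻¹' (Ici 0)) := by
      rw [hK]; ext z; simp only [mem_inter_iff]; tauto
    rw [this]; exact h1.inter h2
  have hK_compact : IsCompact K :=
    (isCompact_Icc.prod isCompact_Icc).of_isClosed_subset hK_closed (by rw [hK]; intro z hz; exact hz.1.1)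
  have hST_closed : IsClosed ST := by
    rw [hST]; exact (hK_compact.image continuous_fst).isClosed
  -- cover
  have hcover : Icc (0:ℝ) 1 ⊆ SA ∪ ST := by
    intro t ht
    rcases hPD' t ht.1 ht.2 with h | ⟨θ, hθ0, hθ1, h1, h2⟩
    · left; rw [hSA]; exact ⟨ht, h⟩
    · right; rw [hST, hK]
      exact ⟨(t, θ), ⟨⟨⟨ht, ⟨hθ0, hθ1⟩⟩, h1⟩, h2⟩, rfl⟩
  -- `1 ∈ SA`: Lemma 3(i) for the pair `e₀`
  have h1A : (1:ℝ) ∈ SA := by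
    rw [hSA]
    refine ⟨⟨zero_le_one, le_rfl⟩, ?_⟩
    show 0 ≤ F₀ 1
    have hW : W₀ 1 = Function.update w e₀ 1 := by
      rw [W₀_def]
      funext f
      by_cases hf2 : f = e₂
      · subst hf2; rw [Function.update_self, Function.update_of_ne h02.symm, hc2one]
      · rw [Function.update_of_ne hf2]
        by_cases hf1 : f = e₁
        · subst hf1; rw [Function.update_self, Function.update_of_ne h01.symm, hc1one]
        · rw [Function.update_of_ne hf1]
    have hps : p 0 ≠ q 0 := fun h => hpO 0 (h ▸ hq 0)
    have hyp' : (prodBernoulli w).real (openConn a b) ≤ (prodBernoulli w).real (openConn (p 0) b) + 0 := by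
      rw [add_zero]; exact hyp 0
    have L := SeqExchange.lemma3i_pair w a (p 0) (q 0) b hps le_rfl hyp'
    rw [zero_mul, add_zero, ← he₀, goodStepEI_real_inter_open_eq w e₀, goodStepEI_real_inter_open_eq w e₀,
      ← hρ₀] at L
    rw [F₀_def, hW]
    have := le_of_mul_le_mul_left L hρ₀pos
    linarith
  -- `0 ∈ ST`: the tie edge for the pairs `e₁, e₂`
  have h0T : (0:ℝ) ∈ ST := by
    have hps₁ : p 1 ≠ q 1 := fun h => hpO 1 (h ▸ hq 1)
    have hps₂ : p 2 ≠ q 2 := fun h => hpO 2 (h ▸ hq 2)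
    have hne : s(p 1, q 1) ≠ s(p 2, q 2) := by rw [← he₁, ← he₂]; exact h12
    have hpos₁ : 0 < (w s(p 1, q 1) : ℝ) := hpos 1
    have hpos₂ : 0 < (w s(p 2, q 2) : ℝ) := hpos 2
    obtain ⟨θ, hθ0, hθ1, hV₁, hV₂⟩ :=
      exists_theta_anchored w a b (p 1) (q 1) (p 2) (q 2) hps₁ hps₂ hne hpos₁ hpos₂ (hlt 1) (hlt 2) (hyp 1) (hyp 2)
    rw [← he₁, ← he₂, ← hρ₂] at hV₁
    rw [← he₁, ← he₂, ← hρ₁] at hV₂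
    -- `W₁ 0 θ` and `W₂ 0 θ` are the two anchored graphs
    have hc0one' : c 0 (1 - 0) = w e₀ := by rw [sub_zero]; exact hc0one
    have hWa : W₁ 0 θ = Function.update (Function.update w e₁ 1) e₂ (c 2 θ) := by
      rw [W₁_def]
      funext f
      by_cases hf2 : f = e₂
      · subst hf2; rw [Function.update_self, Function.update_self]
      · rw [Function.update_of_ne hf2, Function.update_of_ne hf2]
        by_cases hf0 : f = e₀
        · subst hf0; rw [Function.update_self, Function.update_of_ne h01, hc0one']
        · rw [Function.update_of_ne hf0]
    have hWb : W₂ 0 θ = Function.update (Function.update w e₂ 1) e₁ (c 1 (1 - θ)) := by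
      rw [W₂_def]
      funext f
      by_cases hf1 : f = e₁
      · subst hf1; rw [Function.update_self, Function.update_self]
      · rw [Function.update_of_ne hf1, Function.update_of_ne hf1]
        by_cases hf0 : f = e₀
        · subst hf0; rw [Function.update_self, Function.update_of_ne h02, hc0one']
        · rw [Function.update_of_ne hf0]
    have hA := hV₁ (c 2 θ) (hc₂ θ hθ0 hθ1)
    have hB := hV₂ (c 1 (1 - θ)) (hc₁ (1 - θ) (by linarith) (by linarith))
    rw [hST, hK]
    refine ⟨(0, θ), ⟨⟨⟨⟨le_rfl, zero_le_one⟩, ⟨hθ0, hθ1⟩⟩, ?_⟩, ?_⟩, rfl⟩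
    · show 0 ≤ F₁ (0, θ)
      rw [F₁_def, hWa]; linarith
    · show 0 ≤ F₂ (0, θ)
      rw [F₂_def, hWb]; linarith
  ------------------------------------------------------------------
  -- connectedness of `[0,1]`: a common point
  ------------------------------------------------------------------
  have hpre : IsPreconnected (Icc (0:ℝ) 1) := isPreconnected_Icc
  have hne1 : (Icc (0:ℝ) 1 ∩ SA).Nonempty := ⟨1, ⟨zero_le_one, le_rfl⟩, h1A⟩
  have hne0 : (Icc (0:ℝ) 1 ∩ ST).Nonempty := ⟨0, ⟨le_rfl, zero_le_one⟩, h0T⟩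
  obtain ⟨T, hT⟩ : (Icc (0:ℝ) 1 ∩ (SA ∩ ST)).Nonempty :=
    isPreconnected_closed_iff.1 hpre SA ST hSA_closed hST_closed hcover hne1 hne0
  have hT01 : 0 ≤ T ∧ T ≤ 1 := hT.1
  have hV0 : 0 ≤ F₀ T := by
    have := hT.2.1; rw [hSA] at this; exact this.2
  obtain ⟨z, hzK, hzT⟩ : ∃ z ∈ K, z.1 = T := by
    have := hT.2.2; rw [hST] at this
    obtain ⟨z, hz, hzT⟩ := this
    exact ⟨z, hz, hzT⟩
  obtain ⟨Θ, hΘ⟩ : ∃ s : ℝ, s = z.2 := ⟨_, rfl⟩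
  have hzeq : z = (T, Θ) := by rw [← hzT, hΘ]
  rw [hK, hzeq] at hzK
  have hΘ01 : 0 ≤ Θ ∧ Θ ≤ 1 := hzK.1.1.2
  have hV1 : 0 ≤ F₁ (T, Θ) := hzK.1.2
  have hV2 : 0 ≤ F₂ (T, Θ) := hzK.2
  ------------------------------------------------------------------
  -- the tournament certificate at `(T, Θ)`
  ------------------------------------------------------------------
  obtain ⟨x, hx⟩ : ∃ x : Fin 3 → Fin 3 → ℝ, x = fun j k =>
      if j = k then 0 else if j = 0 then T else if k = 0 then 1 - T else if j = 1 then Θ else 1 - Θ := ⟨_, rfl⟩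
  obtain ⟨r, hr⟩ : ∃ r : Option (Fin 3) → Sym2 (Fin n) → unitInterval, r = fun i => match i with
      | none => Function.update (Function.update (Function.update w e₀ 1) e₁ 1) e₂ 1
      | some j => if j = 0 then W₀ T else if j = 1 then W₁ T Θ else W₂ T Θ := ⟨_, rfl⟩
  have hr0 : r (some 0) = W₀ T := by rw [hr]; simp
  have hr1 : r (some 1) = W₁ T Θ := by rw [hr]; simp
  have hr2 : r (some 2) = W₂ T Θ := by rw [hr]; simp
  have hrn : r none = Function.update (Function.update (Function.update w e₀ 1) e₁ 1) e₂ 1 := by rw [hr]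
  have hx01 : x 0 1 = T := (by rw [hx]; simp); have hx02 : x 0 2 = T := (by rw [hx]; simp)
  have hx10 : x 1 0 = 1 - T := (by rw [hx]; simp); have hx20 : x 2 0 = 1 - T := (by rw [hx]; simp)
  have hx12 : x 1 2 = Θ := (by rw [hx]; simp); have hx21 : x 2 1 = 1 - Θ := (by rw [hx]; simp)
  refine blockQ9_threeDangerous_of_tournament w O A a b hOA haO hbO hiso p q hq hpA hpO hinj hlt hdom x ?_ ?_ jc r
    ?_ ?_ ?_ ?_ ?_ ?_
  · -- nonnegativity of the coins
    intro j k
    rw [hx]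
    fin_cases j <;> fin_cases k <;> simp <;> linarith [hT01.1, hT01.2, hΘ01.1, hΘ01.2]
  · -- complementarity
    intro j k hjk
    rw [hx]
    fin_cases j <;> fin_cases k <;> simp at hjk ⊢
  · -- weights off the three pairs
    intro i f hf
    have hf0 : f ≠ e₀ := by rw [he₀]; exact hf 0
    have hf1 : f ≠ e₁ := by rw [he₁]; exact hf 1
    have hf2 : f ≠ e₂ := by rw [he₂]; exact hf 2
    rcases i with _ | j
    · rw [hrn, Function.update_of_ne hf2, Function.update_of_ne hf1, Function.update_of_ne hf0]
    · fin_cases j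
      · show r (some 0) f = w f
        rw [hr0, W₀_def, Function.update_of_ne hf2, Function.update_of_ne hf1, Function.update_of_ne hf0]
      · show r (some 1) f = w f
        rw [hr1, W₁_def, Function.update_of_ne hf2, Function.update_of_ne hf0, Function.update_of_ne hf1]
      · show r (some 2) f = w f
        rw [hr2, W₂_def, Function.update_of_ne hf1, Function.update_of_ne hf0, Function.update_of_ne hf2]
  · -- glued component
    intro j
    fin_cases j
    · show r none s(p 0, q 0) = 1
      rw [← he₀, hrn, Function.update_of_ne h02, Function.update_of_ne h01, Function.update_self]
    · show r none s(p 1, q 1) = 1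
      rw [← he₁, hrn, Function.update_of_ne h12, Function.update_self]
    · show r none s(p 2, q 2) = 1
      rw [← he₂, hrn, Function.update_self]
  · -- anchors
    intro j
    fin_cases j
    · show r (some 0) s(p 0, q 0) = 1
      rw [← he₀, hr0, W₀_def, Function.update_of_ne h02, Function.update_of_ne h01, Function.update_self]
    · show r (some 1) s(p 1, q 1) = 1
      rw [← he₁, hr1, W₁_def, Function.update_of_ne h12, Function.update_of_ne h01.symm, Function.update_self]
    · show r (some 2) s(p 2, q 2) = 1
      rw [← he₂, hr2, W₂_def, Function.update_of_ne h12.symm, Function.update_of_ne h02.symm, Function.update_self]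
  · -- coins
    intro j k hjk
    fin_cases j <;> fin_cases k
    · exact absurd rfl hjk
    · show ((r (some 0) s(p 1, q 1) : unitInterval) : ℝ) = (w s(p 1, q 1) : ℝ) * x 0 1 / (1 - (w s(p 1, q 1) : ℝ) + (w s(p 1, q 1) : ℝ) * x 0 1)
      rw [← he₁, hx01, hr0, W₀_def, Function.update_of_ne h12, Function.update_self, hc₁ T hT01.1 hT01.2, hρ₁]
    · show ((r (some 0) s(p 2, q 2) : unitInterval) : ℝ) = (w s(p 2, q 2) : ℝ) * x 0 2 / (1 - (w s(p 2, q 2) : ℝ) + (w s(p 2, q 2) : ℝ) * x 0 2)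
      rw [← he₂, hx02, hr0, W₀_def, Function.update_self, hc₂ T hT01.1 hT01.2, hρ₂]
    · show ((r (some 1) s(p 0, q 0) : unitInterval) : ℝ) = (w s(p 0, q 0) : ℝ) * x 1 0 / (1 - (w s(p 0, q 0) : ℝ) + (w s(p 0, q 0) : ℝ) * x 1 0)
      rw [← he₀, hx10, hr1, W₁_def, Function.update_of_ne h02, Function.update_self,
        hc₀ (1 - T) (by linarith [hT01.2]) (by linarith [hT01.1]), hρ₀]
    · exact absurd rfl hjk
    · show ((r (some 1) s(p 2, q 2) : unitInterval) : ℝ) = (w s(p 2, q 2) : ℝ) * x 1 2 / (1 - (w s(p 2, q 2) : ℝ) + (w s(p 2, q 2) : ℝ) * x 1 2)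
      rw [← he₂, hx12, hr1, W₁_def, Function.update_self, hc₂ Θ hΘ01.1 hΘ01.2, hρ₂]
    · show ((r (some 2) s(p 0, q 0) : unitInterval) : ℝ) = (w s(p 0, q 0) : ℝ) * x 2 0 / (1 - (w s(p 0, q 0) : ℝ) + (w s(p 0, q 0) : ℝ) * x 2 0)
      rw [← he₀, hx20, hr2, W₂_def, Function.update_of_ne h01, Function.update_self,
        hc₀ (1 - T) (by linarith [hT01.2]) (by linarith [hT01.1]), hρ₀]
    · show ((r (some 2) s(p 1, q 1) : unitInterval) : ℝ) = (w s(p 1, q 1) : ℝ) * x 2 1 / (1 - (w s(p 1, q 1) : ℝ) + (w s(p 1, q 1) : ℝ) * x 2 1)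
      rw [← he₁, hx21, hr2, W₂_def, Function.update_self, hc₁ (1 - Θ) (by linarith [hΘ01.2]) (by linarith [hΘ01.1]), hρ₁]
    · exact absurd rfl hjk
  · -- validity of the three boxes
    intro j
    fin_cases j
    · show (prodBernoulli (r (some 0))).real (openConn a b) ≤ (prodBernoulli (r (some 0))).real (openConn (p 0) b)
      rw [hr0]; rw [F₀_def] at hV0; linarith
    · show (prodBernoulli (r (some 1))).real (openConn a b) ≤ (prodBernoulli (r (some 1))).real (openConn (p 1) b)
      rw [hr1]; rw [F₁_def] at hV1; linarith
    · show (prodBernoulli (r (some 2))).real (openConn a b) ≤ (prodBernoulli (r (some 2))).real (openConn (p 2) b)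
      rw [hr2]; rw [F₂_def] at hV2; linarith
  · -- validity of the glued component
    rw [hrn]; exact hval_glued

end BlockQ9

end

end Summit.CriticalPhenomena.PercolationContinuityZ3.Theorems
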